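import Literature.Computability.Cryptography.YaoFunProgram
import Literature.Computability.Complexity.HashBricks
import HarnessLib

/-!
# The inverter of Yao's reduction is PPT (discharge of `yaoInv_isPPT`) — S05 fully proved

`YaoAmplification.lean` proves S05 (`weakOWFExist_iff_OWFExist`, Yao 1982 / Goldreich 2001
Thm. 2.3.2) modulo two efficiency facts; `YaoFunProgram.lean` discharges the first. This file
discharges the second, `yaoRun_polyTime_holds` — the run function `Yao.Params.run P A` of the
inverter `A'` is polynomial-time for polynomial-time `f` and PPT `B'` — and concludes
**`weakOWFExist_iff_OWFExist_holds`**.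

As in `YaoFunProgram.lean` no machine is programmed: the run function `Yao.Params.run` is written as
a pipeline of plumbing bricks (`PlumbingBricks.lean`) around one clocked loop
(`iterate_mem_FP_of_growth`):

* `IProg.initFn`: from `⟨⟨u, y⟩, r⟩` decode the advice `(idx, κ)` from `|r|` (`modLenFn` by
  `Base(n)`, `divModFn` by `K_b(n)`, both moduli by `polyFn`) and lay out the state
  `⟨1ⁿ, ⟨y, ⟨1ᵐ, ⟨1ᶜ, ⟨1ⁱ, ⟨flag, ⟨answer, coins⟩⟩⟩⟩⟩⟩⟩`, `m = M n + idx`, `c = m + κ`;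
* `IProg.roundFn` = one trial (Goldreich's procedure `I` at position `i`): cut the next coin
  segment (`takeFn`/`dropFn`), evaluate `g` (`yaoFun_polyTime_holds`), splice the padded target
  into the `i`-th component (`takeFn`, `dropFn`, `concatFn`, `pad10Fn`, products of unary numbers by
  `HashBricks.umulFn` of `HashBricks.lean`), run `B'`, read the `i`-th block of its answer, verify it with `f` (`eqPairFn`),
  record the first verified preimage (`iteFn`), advance `i` cyclically (`wrapSucc`);
* `IProg.runFn_boolPair`: the pipeline computes `Params.run`; `yaoRun_polyTime_holds`;
  `weakOWFExist_iff_OWFExist_holds`.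

## References

* O. Goldreich, *Foundations of Cryptography I*, CUP 2001, §2.3.1 (algorithm `A'`, procedure `I`).
* S. Arora, B. Barak, *Computational Complexity: A Modern Approach*, CUP 2009, §1.3, §1.4.1, §7.1.
-/

namespace Literature.Computability.Cryptography

namespace Yao

open _root_.Computability Polynomial Complexity Complexity.Plumb Complexity.Brick Complexity.OracleCompose

namespace IProg

/-- `unaryEncodeNat m = 1ᵐ`, from `unaryEncodeNat_eq_replicate` (`CookReducibilityTransitive.lean`). [folklore] -/
private theorem unaryEncodeNat_eq_ones (m : ℕ) : unaryEncodeNat m = ones m := Complexity.unaryEncodeNat_eq_replicate m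

/-! ### Deeper projections of the state `⟨u, ⟨y, ⟨1ᵐ, ⟨1ᶜ, ⟨1ⁱ, ⟨fl, ⟨ans, coins⟩⟩⟩⟩⟩⟩⟩` -/

/-- Component 5 (`fl`). [folklore] -/
noncomputable abbrev q6 : List Bool → List Bool := nthF 5
/-- Component 6 (`ans`). [folklore] -/
noncomputable abbrev q7 : List Bool → List Bool := nthF 6
/-- Component 7 (`coins`). [folklore] -/
noncomputable abbrev q8 : List Bool → List Bool := sndPow 6

/-- `q6 ∈ FP`. [folklore] -/
theorem q6_mem_FP : q6 ∈ FP := nthF_mem_FP 5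
/-- `q7 ∈ FP`. [folklore] -/
theorem q7_mem_FP : q7 ∈ FP := nthF_mem_FP 6
/-- `q8 ∈ FP`. [folklore] -/
theorem q8_mem_FP : q8 ∈ FP := sndPow_mem_FP 6

/-- The state of the trial loop. [folklore] -/
def aState (n : ℕ) (y : List Bool) (m c i : ℕ) (fl ans coins : List Bool) : List Bool :=
  boolPair (ones n) (boolPair y (boolPair (ones m) (boolPair (ones c) (boolPair (ones i) (boolPair fl (boolPair ans coins))))))

section Proj

variable (n : ℕ) (y : List Bool) (m c i : ℕ) (fl ans coins : List Bool)

/-- Reading `n`. [folklore] -/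
@[simp] theorem p1_aState : fstF (aState n y m c i fl ans coins) = ones n := by simp [aState]
/-- Reading `y`. [folklore] -/
@[simp] theorem p21_aState : (nthF 1) (aState n y m c i fl ans coins) = y := by simp [aState]
/-- Reading `m`. [folklore] -/
@[simp] theorem p221_aState : (nthF 2) (aState n y m c i fl ans coins) = ones m := by simp [aState]
/-- Reading `c`. [folklore] -/
@[simp] theorem p2221_aState : (nthF 3) (aState n y m c i fl ans coins) = ones c := by simp [aState]
/-- Reading `i`. [folklore] -/
@[simp] theorem p22221_aState : (nthF 4) (aState n y m c i fl ans coins) = ones i := by simp [aState]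
/-- Reading `fl`. [folklore] -/
@[simp] theorem q6_aState : q6 (aState n y m c i fl ans coins) = fl := by simp [aState]
/-- Reading `ans`. [folklore] -/
@[simp] theorem q7_aState : q7 (aState n y m c i fl ans coins) = ans := by simp [aState]
/-- Reading `coins`. [folklore] -/
@[simp] theorem q8_aState : q8 (aState n y m c i fl ans coins) = coins := by simp [aState]

end Proj

/-! ### The pieces of one trial -/

variable (P : Params) (A : Adv)

/-- The coin segment of this trial: `coins ↾ c`. [folklore] -/
noncomputable def segFn : List Bool → List Bool := takeFn ∘ fanoutFn (nthF 3) q8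
/-- The sampled input `w = seg ↾ m`. [folklore] -/
noncomputable def wFn : List Bool → List Bool := takeFn ∘ fanoutFn (nthF 2) segFn
/-- `B'`'s coins `seg ⇂ m`. [folklore] -/
noncomputable def rBFn : List Bool → List Bool := dropFn ∘ fanoutFn (nthF 2) segFn
/-- `g(w)`. [folklore] -/
noncomputable def gwFn : List Bool → List Bool := P.g ∘ wFn
/-- The component width `1^{cw(n)}`. [folklore] -/
noncomputable def cwFn : List Bool → List Bool := polyFn P.cwpoly ∘ fstF
/-- The offset `1^{i·cw}`. [folklore] -/
noncomputable def offFn : List Bool → List Bool := HashBricks.umulFn ∘ fanoutFn (nthF 4) (cwFn P)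
/-- The padded target `pad_n y`. [folklore] -/
noncomputable def padYFn : List Bool → List Bool := pad10Fn ∘ fanoutFn (polyFn P.p ∘ fstF) (nthF 1)
/-- **The hybrid** `splice (g w) i cw (pad y)`. [folklore] -/
noncomputable def spliceFn : List Bool → List Bool :=
  concatFn ∘ fanoutFn (takeFn ∘ fanoutFn (offFn P) (gwFn P))
    (fanoutFn (padYFn P) (dropFn ∘ fanoutFn (concatFn ∘ fanoutFn (offFn P) (cwFn P)) (gwFn P)))
/-- `B'` as a string function `⟨q, r⟩ ↦ B'(q; r)`. [folklore] -/
noncomputable def bFn : List Bool → List Bool := Function.uncurry A.B.run ∘ boolUnpair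
/-- `B'`'s answer `z`. [folklore] -/
noncomputable def zFn : List Bool → List Bool := bFn A ∘ fanoutFn (fanoutFn (nthF 2) (spliceFn P)) (rBFn)
/-- The candidate: the `i`-th `n`-block of `z` (cut with `1ⁿ`, hence never longer than `n`). [folklore] -/
noncomputable def candFn : List Bool → List Bool :=
  takeFn ∘ fanoutFn fstF (dropFn ∘ fanoutFn (HashBricks.umulFn ∘ fanoutFn (nthF 4) fstF) (zFn P A))
/-- The verification bit `[f cand = y]`. [folklore] -/
noncomputable def hitFn : List Bool → List Bool := eqPairFn ∘ fanoutFn (P.f ∘ candFn P A) (nthF 1)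
/-- The bit `[fl = ε]` (nothing found yet). [folklore] -/
noncomputable def freshFn : List Bool → List Bool := lenLeFn 0 ∘ fanoutFn fstF q6
/-- The new flag. [folklore] -/
noncomputable def flFn : List Bool → List Bool := iteFn freshFn (iteFn (hitFn P A) (fun _ => [true]) q6) q6
/-- The new answer. [folklore] -/
noncomputable def ansFn : List Bool → List Bool := iteFn freshFn (iteFn (hitFn P A) (candFn P A) q7) q7
/-- The new position `(i + 1) mod t(n)`. [folklore] -/
noncomputable def posFn : List Bool → List Bool := wrapSucc ∘ fanoutFn (polyFn P.Tpoly ∘ fstF) (nthF 4)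
/-- The remaining coins. [folklore] -/
noncomputable def coinsFn : List Bool → List Bool := dropFn ∘ fanoutFn (nthF 3) q8

/-- **One round = one trial.** [Goldreich 2001, §2.3.1, procedure `I`] [folklore] -/
noncomputable def roundFn : List Bool → List Bool :=
  fanoutFn fstF (fanoutFn (nthF 1) (fanoutFn (nthF 2) (fanoutFn (nthF 3)
    (fanoutFn (posFn P) (fanoutFn (flFn P A) (fanoutFn (ansFn P A) coinsFn))))))

/-! ### The initial state and the whole pipeline -/

/-- `1ⁿ` from `⟨⟨u, y⟩, r⟩`. [folklore] -/
noncomputable def uFn : List Bool → List Bool := onesFn ∘ fstF ∘ fstF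
/-- `⟨1^{idx}, 1^κ⟩ = divMod (|r| mod Base n) (K_b n)`. [folklore] -/
noncomputable def dmFn : List Bool → List Bool :=
  divModFn ∘ fanoutFn (polyFn (P.Kpoly A) ∘ uFn) (modLenFn ∘ fanoutFn (polyFn (P.Bpoly A) ∘ uFn) sndF)
/-- `1ᵐ`, `m = M n + idx`. [folklore] -/
noncomputable def mFn : List Bool → List Bool := concatFn ∘ fanoutFn (polyFn P.Mpoly ∘ uFn) (fstF ∘ dmFn P A)
/-- `1ᶜ`, `c = m + κ`. [folklore] -/
noncomputable def cFn : List Bool → List Bool := concatFn ∘ fanoutFn (mFn P A) (sndF ∘ dmFn P A)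
/-- **The initial state** from `⟨⟨u, y⟩, r⟩`. [folklore] -/
noncomputable def initFn : List Bool → List Bool :=
  fanoutFn uFn (fanoutFn (sndF ∘ fstF) (fanoutFn (mFn P A) (fanoutFn (cFn P A)
    (fanoutFn (fun _ => []) (fanoutFn (fun _ => []) (fanoutFn (fun _ => []) sndF))))))

/-- **The run function of `A'` as a string function on `⟨inp, r⟩`.** [folklore] -/
noncomputable def runFn : List Bool → List Bool :=
  q7 ∘ (fun z => (roundFn P A)^[(P.Rpoly A).eval (boolUnpair z).1.length] z) ∘ initFn P A

/-! ### `FP` membership -/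

variable {P A}

/-- The round keeps the first component. [folklore] -/
theorem roundFn_fst (w : List Bool) : (boolUnpair (roundFn P A w)).1 = (boolUnpair w).1 := by
  simp [roundFn, fstF]

/-- **Linear growth of the round on every word.** [folklore] -/
theorem length_roundFn_le (w : List Bool) : (roundFn P A w).length ≤ w.length + 20 * ((boolUnpair w).1.length + 1) := by
  have h1 := length_boolUnpair_parts_le w
  have h2 := length_boolUnpair_parts_le (boolUnpair w).2
  have h3 := length_boolUnpair_parts_le (boolUnpair (boolUnpair w).2).2
  have h4 := length_boolUnpair_parts_le (boolUnpair (boolUnpair (boolUnpair w).2).2).2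
  have h5 := length_boolUnpair_parts_le (boolUnpair (boolUnpair (boolUnpair (boolUnpair w).2).2).2).2
  have h6 := length_boolUnpair_parts_le (boolUnpair (boolUnpair (boolUnpair (boolUnpair (boolUnpair w).2).2).2).2).2
  have h7 := length_boolUnpair_parts_le (boolUnpair (boolUnpair (boolUnpair (boolUnpair (boolUnpair (boolUnpair w).2).2).2).2).2).2
  have hpos : (posFn P w).length ≤ ((nthF 4) w).length + 1 := by
    have := length_wrapSucc_le (fanoutFn (polyFn P.Tpoly ∘ fstF) (nthF 4) w)
    simpa [posFn] using this
  have hfl : (flFn P A w).length ≤ (q6 w).length + 1 := by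
    unfold flFn
    rcases lenLeFn_eq_or 0 (fanoutFn fstF q6 w) with h | h
    · rw [iteFn_apply_true (by simpa [freshFn] using h)]
      rcases eqPairFn_eq_or (fanoutFn (P.f ∘ candFn P A) (nthF 1) w) with h' | h'
      · rw [iteFn_apply_true (by simpa [hitFn] using h')]; simp
      · rw [iteFn_apply_false (by simpa [hitFn] using h')]; simp
    · rw [iteFn_apply_false (by simpa [freshFn] using h)]; simp
  have hans : (ansFn P A w).length ≤ (q7 w).length + (boolUnpair w).1.length := by
    unfold ansFn
    rcases lenLeFn_eq_or 0 (fanoutFn fstF q6 w) with h | h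
    · rw [iteFn_apply_true (by simpa [freshFn] using h)]
      rcases eqPairFn_eq_or (fanoutFn (P.f ∘ candFn P A) (nthF 1) w) with h' | h'
      · rw [iteFn_apply_true (by simpa [hitFn] using h')]
        simp only [candFn, Function.comp_apply, fanoutFn_apply, takeFn_boolPair, List.length_take, fstF]
        omega
      · rw [iteFn_apply_false (by simpa [hitFn] using h')]; simp
    · rw [iteFn_apply_false (by simpa [freshFn] using h)]; simp
  have hcoins : (coinsFn w).length ≤ (q8 w).length := by
    simp [coinsFn]
  simp only [roundFn, fanoutFn_apply, length_boolPair]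
  simp only [nthF, sndPow, fstF, sndF, q6, q7, q8, Function.comp_apply] at hpos hfl hans hcoins h1 h2 h3 h4 h5 h6 h7 ⊢
  omega

/-- `roundFn ∈ FP`. [folklore] -/
theorem roundFn_mem_FP (hf : PolyTimeComputable id id P.f) (hB : IsPPT A.B id) : roundFn P A ∈ FP := by
  have hg : P.g ∈ FP := yaoFun_polyTime_holds P hf
  have hseg : segFn ∈ FP := comp_mem_FP takeFn_mem_FP (fanoutFn_mem_FP (nthF_mem_FP 3) q8_mem_FP)
  have hw : wFn ∈ FP := comp_mem_FP takeFn_mem_FP (fanoutFn_mem_FP (nthF_mem_FP 2) hseg)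
  have hrB : rBFn ∈ FP := comp_mem_FP dropFn_mem_FP (fanoutFn_mem_FP (nthF_mem_FP 2) hseg)
  have hgw : gwFn P ∈ FP := comp_mem_FP hg hw
  have hcw : cwFn P ∈ FP := comp_mem_FP (polyFn_mem_FP _) fstF_mem_FP
  have hoff : offFn P ∈ FP := comp_mem_FP HashBricks.umulFn_mem_FP (fanoutFn_mem_FP (nthF_mem_FP 4) hcw)
  have hpad : padYFn P ∈ FP := comp_mem_FP pad10Fn_mem_FP (fanoutFn_mem_FP (comp_mem_FP (polyFn_mem_FP _) fstF_mem_FP) (nthF_mem_FP 1))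
  have hsplice : spliceFn P ∈ FP :=
    comp_mem_FP concatFn_mem_FP (fanoutFn_mem_FP (comp_mem_FP takeFn_mem_FP (fanoutFn_mem_FP hoff hgw))
      (fanoutFn_mem_FP hpad (comp_mem_FP dropFn_mem_FP (fanoutFn_mem_FP (comp_mem_FP concatFn_mem_FP (fanoutFn_mem_FP hoff hcw)) hgw))))
  have hb : bFn A ∈ FP := PolyTimeComputable.comp_holds (by simpa [bFn] using hB.1) polyTimeComputable_boolUnpair
  have hz : zFn P A ∈ FP := comp_mem_FP hb (fanoutFn_mem_FP (fanoutFn_mem_FP (nthF_mem_FP 2) hsplice) hrB)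
  have hcand : candFn P A ∈ FP :=
    comp_mem_FP takeFn_mem_FP (fanoutFn_mem_FP fstF_mem_FP (comp_mem_FP dropFn_mem_FP
      (fanoutFn_mem_FP (comp_mem_FP HashBricks.umulFn_mem_FP (fanoutFn_mem_FP (nthF_mem_FP 4) fstF_mem_FP)) hz)))
  have hhit : hitFn P A ∈ FP := comp_mem_FP eqPairFn_mem_FP (fanoutFn_mem_FP (comp_mem_FP hf hcand) (nthF_mem_FP 1))
  have hfresh : freshFn ∈ FP := comp_mem_FP (lenLeFn_mem_FP 0) (fanoutFn_mem_FP fstF_mem_FP q6_mem_FP)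
  have hfl : flFn P A ∈ FP := iteFn_mem_FP hfresh (iteFn_mem_FP hhit (const_mem_FP _) q6_mem_FP) q6_mem_FP
  have hans : ansFn P A ∈ FP := iteFn_mem_FP hfresh (iteFn_mem_FP hhit hcand q7_mem_FP) q7_mem_FP
  have hposm : posFn P ∈ FP := by
    unfold posFn wrapSucc
    exact comp_mem_FP (iteFn_mem_FP (comp_mem_FP eqPairFn_mem_FP (fanoutFn_mem_FP (comp_mem_FP (cons_mem_FP true) sndF_mem_FP) fstF_mem_FP))
      (const_mem_FP []) (comp_mem_FP (cons_mem_FP true) sndF_mem_FP))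
      (fanoutFn_mem_FP (comp_mem_FP (polyFn_mem_FP _) fstF_mem_FP) (nthF_mem_FP 4))
  have hcoins : coinsFn ∈ FP := comp_mem_FP dropFn_mem_FP (fanoutFn_mem_FP (nthF_mem_FP 3) q8_mem_FP)
  exact fanoutFn_mem_FP fstF_mem_FP (fanoutFn_mem_FP (nthF_mem_FP 1) (fanoutFn_mem_FP (nthF_mem_FP 2) (fanoutFn_mem_FP (nthF_mem_FP 3)
    (fanoutFn_mem_FP hposm (fanoutFn_mem_FP hfl (fanoutFn_mem_FP hans hcoins))))))

/-- `runFn ∈ FP`. [folklore] -/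
theorem runFn_mem_FP (hf : PolyTimeComputable id id P.f) (hB : IsPPT A.B id) : runFn P A ∈ FP := by
  have hu : uFn ∈ FP := comp_mem_FP onesFn_mem_FP (comp_mem_FP fstF_mem_FP fstF_mem_FP)
  have hdm : dmFn P A ∈ FP :=
    comp_mem_FP divModFn_mem_FP (fanoutFn_mem_FP (comp_mem_FP (polyFn_mem_FP _) hu)
      (comp_mem_FP modLenFn_mem_FP (fanoutFn_mem_FP (comp_mem_FP (polyFn_mem_FP _) hu) sndF_mem_FP)))
  have hm : mFn P A ∈ FP := comp_mem_FP concatFn_mem_FP (fanoutFn_mem_FP (comp_mem_FP (polyFn_mem_FP _) hu) (comp_mem_FP fstF_mem_FP hdm))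
  have hc : cFn P A ∈ FP := comp_mem_FP concatFn_mem_FP (fanoutFn_mem_FP hm (comp_mem_FP sndF_mem_FP hdm))
  have hinit : initFn P A ∈ FP :=
    fanoutFn_mem_FP hu (fanoutFn_mem_FP (comp_mem_FP sndF_mem_FP fstF_mem_FP) (fanoutFn_mem_FP hm (fanoutFn_mem_FP hc
      (fanoutFn_mem_FP (const_mem_FP []) (fanoutFn_mem_FP (const_mem_FP []) (fanoutFn_mem_FP (const_mem_FP []) sndF_mem_FP))))))
  exact comp_mem_FP q7_mem_FP (comp_mem_FP
    (iterate_mem_FP_of_growth (roundFn_mem_FP hf hB) 20 roundFn_fst length_roundFn_le (P.Rpoly A)) hinit)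

/-! ### Semantics -/

/-- The initial state from `⟨⟨u, y⟩, r⟩`. [folklore] -/
theorem initFn_boolPair (u y r : List Bool) :
    initFn P A (boolPair (boolPair u y) r) =
      aState u.length y (P.M u.length + r.length % P.Base A u.length / P.Kb A u.length)
        (P.M u.length + r.length % P.Base A u.length / P.Kb A u.length + r.length % P.Base A u.length % P.Kb A u.length)
        0 [] [] r := by
  simp [initFn, aState, uFn, mFn, cFn, dmFn, onesFn, unaryEncodeNat_eq_ones, Params.Kb, Params.Base]

/-- First-hit bookkeeping: the pair `(flag, answer)` attached to an optional answer. [folklore] -/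
def enc : Option (List Bool) → List Bool × List Bool
  | none => ([], [])
  | some v => ([true], v)

variable (P A) in
/-- The optional answer after `kk` trials. [folklore] -/
noncomputable def hitsUpTo (n m c : ℕ) (y r : List Bool) (kk : ℕ) : Option (List Bool) :=
  (List.range kk).findSome? fun j => P.trial A n m (j % P.T n) y (sgt c j r)

/-- `hitsUpTo` at `R(n)` is `hits`. [folklore] -/
theorem hitsUpTo_R (n m c : ℕ) (y r : List Bool) : hitsUpTo P A n m c y r (P.R A n) = P.hits A n m c y r := rfl

/-- One more trial. [folklore] -/
theorem hitsUpTo_succ (n m c : ℕ) (y r : List Bool) (kk : ℕ) :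
    hitsUpTo P A n m c y r (kk + 1) = (hitsUpTo P A n m c y r kk).or (P.trial A n m (kk % P.T n) y (sgt c kk r)) := by
  simp [hitsUpTo, List.range_succ, List.findSome?_append]

/-- **Semantics of one round on a state of the computation.** [Goldreich 2001, §2.3.1] [folklore] -/
theorem roundFn_aState (n : ℕ) (y : List Bool) (m c i : ℕ) (o : Option (List Bool)) (co : List Bool) :
    roundFn P A (aState n y m c i (enc o).1 (enc o).2 co) =
      aState n y m c (if i + 1 = P.T n then 0 else i + 1) (enc (o.or (P.trial A n m i y (co.take c)))).1
        (enc (o.or (P.trial A n m i y (co.take c)))).2 (co.drop c) := by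
  set S := aState n y m c i (enc o).1 (enc o).2 co with hS
  have hp1 : fstF S = ones n := by simp [hS]
  have hp21 : (nthF 1) S = y := by simp [hS]
  have hp221 : (nthF 2) S = ones m := by simp [hS]
  have hp2221 : (nthF 3) S = ones c := by simp [hS]
  have hp22221 : (nthF 4) S = ones i := by simp [hS]
  have hq6 : q6 S = (enc o).1 := by simp [hS]
  have hq7 : q7 S = (enc o).2 := by simp [hS]
  have hq8 : q8 S = co := by simp [hS]
  set seg := co.take c with hseg
  have hsegv : segFn S = seg := by simp [segFn, hp2221, hq8, hseg]
  have hwv : wFn S = seg.take m := by simp [wFn, hsegv, hp221]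
  have hrBv : rBFn S = seg.drop m := by simp [rBFn, hsegv, hp221]
  have hgwv : gwFn P S = P.g (seg.take m) := by simp [gwFn, hwv]
  have hcwv : cwFn P S = ones (P.cw n) := by simp [cwFn, hp1]
  have hoffv : offFn P S = ones (i * P.cw n) := by simp [offFn, hcwv, hp22221]
  have hpadv : padYFn P S = P.pad n y := by simp [padYFn, hp1, hp21, Params.pad]
  have hsplicev : spliceFn P S = splice (P.g (seg.take m)) i (P.cw n) (P.pad n y) := by
    simp [spliceFn, hoffv, hgwv, hpadv, hcwv, splice, Nat.add_mul]
  set z := A.B.run (boolPair (unaryEncodeNat m) (splice (P.g (seg.take m)) i (P.cw n) (P.pad n y))) (seg.drop m) with hz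
  have hzv : zFn P A S = z := by
    simp [zFn, bFn, hsplicev, hrBv, hp221, hz, unaryEncodeNat_eq_ones]
  have hcandv : candFn P A S = blk n i z := by
    simp [candFn, hzv, hp1, hp22221, blk]
  have hhitv : hitFn P A S = [decide (P.f (blk n i z) = y)] := by
    simp [hitFn, hcandv, hp21, eqPairFn_boolPair]
  have hfreshv : freshFn S = [decide ((enc o).1 = [])] := by
    cases o <;> simp [freshFn, hp1, hq6, enc, lenLeFn_boolPair]
  have htrial : P.trial A n m i y seg = if P.f (blk n i z) = y then some (blk n i z) else none := rfl
  have hposv : posFn P S = ones (if i + 1 = P.T n then 0 else i + 1) := by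
    simp only [posFn, Function.comp_apply, fanoutFn_apply, polyFn_apply, hp1, hp22221, List.length_replicate,
      Params.eval_Tpoly, wrapSucc_boolPair]
  have hcoinsv : coinsFn S = co.drop c := by
    simp [coinsFn, hp2221, hq8]
  have hflv : flFn P A S = (enc (o.or (P.trial A n m i y seg))).1 := by
    unfold flFn
    cases o with
    | some v =>
      rw [iteFn_apply_false (by rw [hfreshv]; rfl)]
      simp [hq6, enc]
    | none =>
      rw [iteFn_apply_true (by rw [hfreshv]; rfl), htrial]
      by_cases hh : P.f (blk n i z) = y
      · rw [iteFn_apply_true (by rw [hhitv, decide_eq_true hh]), if_pos hh]; rfl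
      · rw [iteFn_apply_false (by rw [hhitv, decide_eq_false hh]), if_neg hh]; simp [hq6, enc]
  have hansv : ansFn P A S = (enc (o.or (P.trial A n m i y seg))).2 := by
    unfold ansFn
    cases o with
    | some v =>
      rw [iteFn_apply_false (by rw [hfreshv]; rfl)]
      simp [hq7, enc]
    | none =>
      rw [iteFn_apply_true (by rw [hfreshv]; rfl), htrial]
      by_cases hh : P.f (blk n i z) = y
      · rw [iteFn_apply_true (by rw [hhitv, decide_eq_true hh]), if_pos hh, hcandv]; rfl
      · rw [iteFn_apply_false (by rw [hhitv, decide_eq_false hh]), if_neg hh]; simp [hq7, enc]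
  rw [roundFn]
  simp only [fanoutFn_apply, hp1, hp21, hp221, hp2221, hposv, hflv, hansv, hcoinsv]
  rfl

/-- **Rounds of the trial loop** from the initial state. [folklore] -/
theorem iterate_roundFn (n : ℕ) (y : List Bool) (m c : ℕ) (r : List Bool) : ∀ kk,
    (roundFn P A)^[kk] (aState n y m c 0 [] [] r) =
      aState n y m c (kk % P.T n) (enc (hitsUpTo P A n m c y r kk)).1 (enc (hitsUpTo P A n m c y r kk)).2 (r.drop (kk * c))
  | 0 => by simp [hitsUpTo, enc]
  | kk + 1 => by
    rw [Function.iterate_succ_apply', iterate_roundFn n y m c r kk, roundFn_aState, hitsUpTo_succ, ← mod_succ_eq,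
      List.drop_drop, Nat.succ_mul]
    rfl

/-- **The pipeline computes the run function of `A'`.** [folklore] -/
theorem runFn_boolPair (inp r : List Bool) : runFn P A (boolPair inp r) = P.run A inp r := by
  have hinp : inp = boolPair (boolUnpair inp).1 (boolUnpair inp).2 ∨ True := Or.inr trivial
  rw [runFn, Function.comp_apply, Function.comp_apply]
  have hinit : initFn P A (boolPair inp r) = initFn P A (boolPair (boolPair (boolUnpair inp).1 (boolUnpair inp).2) r) := by
    simp [initFn, uFn, mFn, cFn, dmFn, fstF, sndF]
  rw [hinit, initFn_boolPair]
  set n := (boolUnpair inp).1.length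
  rw [show (boolUnpair (aState n (boolUnpair inp).2 _ _ 0 [] [] r)).1.length = n by simp [aState], Params.eval_Rpoly,
    iterate_roundFn, q7_aState, hitsUpTo_R, Params.run]
  cases P.hits A n _ _ (boolUnpair inp).2 r <;> rfl

end IProg

end Yao

/-- **Discharge of `yaoRun_polyTime`**: the run function of the inverter `A'` of Yao's reduction is
polynomial-time — it is `Yao.IProg.runFn ∈ FP` transported to the pair presentation. [Goldreich 2001, §2.3.1 ("a probabilistic polynomial-time
algorithm `A'` for inverting `f`")] [cite: Goldreich2001, Thm. 2.3.2 (proof)] -/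
theorem yaoRun_polyTime_holds : yaoRun_polyTime := by
  intro P A hf hB
  open Complexity in
  obtain ⟨p, M, hM⟩ := Yao.IProg.runFn_mem_FP (P := P) (A := A) hf hB
  refine ⟨p, M, fun q => ?_⟩
  have h := hM (boolPair q.1 q.2)
  rw [id, Yao.IProg.runFn_boolPair] at h
  exact h

/-- **S05, Yao's amplification, fully proved**: weak one-way functions exist iff (strong) one-way
functions exist. [Yao 1982; Goldreich 2001, Thm. 2.3.2] [cite: Goldreich2001, Thm. 2.3.2] -/
theorem weakOWFExist_iff_OWFExist_holds : weakOWFExist_iff_OWFExist :=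
  weakOWFExist_iff_OWFExist_of yaoFun_polyTime_holds yaoRun_polyTime_holds

end Literature.Computability.Cryptography
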